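import Summits.ResolutionOfSingularities.ResolutionOfSingularities.Theorems.UniformComplexityCampaignW82FamilyResolution
import Mathlib.Topology.KrullDimension
import HarnessLib

/-!
# [OURS · L1 W8.2] RESOLUTION IN FAMILIES, GRADED BY THE FIBRE DIMENSION — door 2
# (`UniformComplexity` / `PrimeModelTransfer`) of slot W8.2; campaign statements, Theses-free module

Cell `res-hironaka` (run/shared/lean/pub/res-hironaka/), LADDER-RESOLUTION rung L (RESCUE), slot W8.2 of
plan/RESCUE-SEED.md («PRIME-FIELD / UNIVERSALITY TRANSFER instead of descent: resolve over 𝔽_p or 𝔽̄_p and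
transfer FAMILIES»). SECOND DOOR: route `UniformComplexity`, item `PrimeModelTransfer`
(stmt-ResolutionOfSingularities-8933). Sequel of the OURS module
`Theorems/UniformComplexityCampaignW82FamilyResolution.lean` (p526769: `CampaignW82.IsWeakResolution`,
`CampaignW82.FamilyResolution k`), whose ungraded statement is kernel-checked EQUIVALENT to the crux
slice (`CampaignW82.primeModelTransferAt_iff_familyResolution`, `CampaignW82.algClosedRes_iff_familyResolution`,
`Theorems/UniformComplexityCampaignW82FamilyResolutionLinks.lean`, p530650). Self-typed by the slot's prover
res-L1-s82-pv-2 (gen 5) under the rung-B precedent; NOTHING is proved about resolution of singularities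
here: one `def` and two pure-logic anchors.

WHY THIS FILE. By the prover's SPREADING THEOREM (`PrimeModelTransfer.exists_familyResolution_datum`,
p529834) the family-resolution datum of ONE proper family exists as soon as its geometric generic fibre
`𝒳 ×_A Spec (Frac A)^{alg}` has a resolution — so RESOLUTION IN FAMILIES inherits the dimension grading of
resolution itself: it is a THEOREM for families of CURVES over every finitely generated domain over every
field (resolution of curves, tree `Resolution.hasResolution_of_dim_le_one`), a theorem MODULO the named
fact F-02 (`CossartPiltant2019`) for fibre dimension `≤ 3`, and open from fibre dimension `4` on (where it
is equivalent, over `𝔽̄_p` and summed over all dimensions, to the crux). This module types the graded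
statement so that those rungs are stated BY NAME (prover's file
`Theorems/UniformComplexityCampaignW82FamilyResolutionRungs.lean`):

* `FamilyResolutionDimLe k n` (`n : WithBot ℕ∞`, the value type of `topologicalKrullDim`) — the clause of
  `FamilyResolution k` for the proper families whose (integral) geometric generic fibre has dimension
  `≤ n`;
* anchors `familyResolution_iff_familyResolutionDimLe_top` (`⊤` is the ungraded statement) and
  `familyResolutionDimLe_anti` (antitone in `n`).

HONEST FRAMING. The `def` below is OURS — a campaign statement that REPLACES THE ROLE of a printed item of
H. Hironaka's manuscript *Resolution of singularities in positive characteristics* (2017-03-23,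
[Hironaka2017], lit key `paper:url-3343fd9e678b`) — namely §17 ¶2, p.89 l.59–62 («When the K has
transcendence degree d we can reformulate the resolution problem to the case of dimension d + dim Z» —
the variety as a FAMILY over the prime field; typed AS PRINTED, not asserted, as `S17Methodology.U89_3`),
graded by the fibre dimension `dim Z`; NOT a statement of the manuscript. Hironaka's statements are
CANDIDATES under adjudication (D-0012/D-0089); nothing here is attributed to the author and no verdict on
the manuscript is implied. AI typing, weaker than expert review.

VACUITY SELF-CHECK (`k` any field): `FamilyResolutionDimLe k n` is trivially true at `n = ⊥` (an integral
scheme is non-empty, so no family qualifies); a THEOREM at `n ≤ 1` (prover's `familyResolutionDimLe_one`,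
unconditional) and at `n ≤ 3` modulo F-02 (`familyResolutionDimLe_three_of_cossartPiltant`); not trivially
true at `n ≥ 4` for `k` of positive characteristic (at `n = ⊤`, `k = 𝔽̄_p` it is the crux slice's
conclusion given resolution over `𝔽̄_p`, p530650); never trivially false (it follows from resolution of
the geometric generic fibres, by the spreading theorem).

## References (vocabulary and locators only; nothing cited as a premise)
* H. Hironaka, ms. 2017-03-23, §17 ¶2 p.89 l.59–62 — under adjudication, quoted for the role replaced, not
  asserted. [Hironaka2017]
* A. Grothendieck, J. Dieudonné, EGA IV₃ (1966) Thm. 8.10.5 (spreading out; docstring vocabulary). [EGAIV3]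
-/

noncomputable section

set_option linter.dupNamespace false -- mandated namespace of this single-conjunct summit

open _root_.CategoryTheory _root_.CategoryTheory.Limits _root_.AlgebraicGeometry
open Literature.AlgebraicGeometry.Resolution

namespace Summit.ResolutionOfSingularities.ResolutionOfSingularities.Theorems.CampaignW82

/-- [OURS · L1 W8.2 door 2] replaces the role of §17 ¶2, p.89 l.59–62 (the variety over a field of
transcendence degree `d` as a FAMILY «of dimension d + dim Z» over the prime field; `S17Methodology.U89_3`),
GRADED BY THE FIBRE DIMENSION `dim Z ≤ n`; NOT a statement of the manuscript. **RESOLUTION IN FAMILIES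
over `k` in fibre dimension `≤ n`** (`n : WithBot ℕ∞`): for every finitely generated `k`-domain `A` and
every PROPER `f : 𝒳 → Spec A` whose geometric generic fibre `𝒳 ×_{Spec A} Spec (Frac A)^{alg}`
(`AlgebraicClosure (FractionRing A)`) is INTEGRAL and of dimension `≤ n` (`topologicalKrullDim`), there are
a domain `A'` with an injective, finite-type, algebraic `A`-algebra structure and ONE morphism
`G : 𝒴 → 𝒳 ×_{Spec A} Spec A'` whose fibre over every field-valued point `A' → Ω` is a weak resolution
(`IsWeakResolution`: proper, regular source, isomorphism over a non-empty open) — verbatim the clause of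
`FamilyResolution k` (p526769) with the extra dimension hypothesis; `⊤` gives back `FamilyResolution k`
(`familyResolution_iff_familyResolutionDimLe_top`), antitone in `n` (`familyResolutionDimLe_anti`).
Intended theorems (res-L1-s82-pv-2 gen 5, `…FamilyResolutionRungs.lean`): `FamilyResolutionDimLe k 1` for
EVERY field `k` (curves: the geometric generic fibre is a curve over an algebraically closed field, resolved
by normalisation, tree `hasResolution_of_dim_le_one`, then spread by `exists_familyResolution_datum`,
p529834); `CossartPiltant2019 → FamilyResolutionDimLe k 3`. Vacuity: trivially true at `n = ⊥` only
(integral schemes are non-empty); open for `n ≥ 4` in positive characteristic; never trivially false.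
[folklore] -/
def FamilyResolutionDimLe (k : Type) [Field k] (n : WithBot ℕ∞) : Prop :=
  ∀ (A : Type) [CommRing A] [IsDomain A] [Algebra k A], Algebra.FiniteType k A →
    ∀ (𝒳 : Scheme.{0}) (f : 𝒳 ⟶ Spec (.of A)), IsProper f →
      IsIntegral (pullback f (Spec.map (CommRingCat.ofHom
          (algebraMap A (AlgebraicClosure (FractionRing A)))))) →
      topologicalKrullDim ↥(pullback f (Spec.map (CommRingCat.ofHom
          (algebraMap A (AlgebraicClosure (FractionRing A)))))) ≤ n →
      ∃ (A' : Type) (_ : CommRing A') (_ : IsDomain A') (_ : Algebra A A'),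
        Function.Injective (algebraMap A A') ∧ Algebra.FiniteType A A' ∧ Algebra.IsAlgebraic A A' ∧
        ∃ (𝒴 : Scheme.{0})
          (G : 𝒴 ⟶ pullback f (Spec.map (CommRingCat.ofHom (algebraMap A A')))),
          ∀ (Ω : Type) [Field Ω] (φ : A' →+* Ω),
            IsWeakResolution
              (pullback.snd G
                (pullback.fst (pullback.snd f (Spec.map (CommRingCat.ofHom (algebraMap A A'))))
                  (Spec.map (CommRingCat.ofHom φ))))

/-- Anchor (pure logic): the ungraded `FamilyResolution k` is the grade `⊤`. [folklore] -/
theorem familyResolution_iff_familyResolutionDimLe_top (k : Type) [Field k] :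
    FamilyResolution k ↔ FamilyResolutionDimLe k ⊤ :=
  ⟨fun h A _ _ _ hA 𝒳 f hf hint _ => h A hA 𝒳 f hf hint,
    fun h A _ _ _ hA 𝒳 f hf hint => h A hA 𝒳 f hf hint le_top⟩

/-- Anchor (pure logic): `FamilyResolutionDimLe k n` is antitone in `n`. [folklore] -/
theorem familyResolutionDimLe_anti (k : Type) [Field k] {m n : WithBot ℕ∞} (hmn : m ≤ n)
    (h : FamilyResolutionDimLe k n) : FamilyResolutionDimLe k m :=
  fun A _ _ _ hA 𝒳 f hf hint hdim => h A hA 𝒳 f hf hint (hdim.trans hmn)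

end Summit.ResolutionOfSingularities.ResolutionOfSingularities.Theorems.CampaignW82

end
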